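import Mathlib
import Literature.Analysis.FluidPDE.Tao2016AveragedNS.BoundedEternalSolutions
import Summits.NavierStokesRegularity.NavierStokesRegularity.Theorems.TaoLadderRungTwoBreakCircuitTableDefs
import HarnessLib

/-!
# The cell's tables T4 and B8 as members of `InTableClass R`: T4 ∈ E₂(15) for `0 ≤ ε₀ ≤ 0.21`, B8 ∈ E₂(14) for
# `0 ≤ ε₀ ≤ 0.1236` (cell harvest/h2-tao-ladder, seat p2; support for K1(1) = `NoSurvivingDSSOne`, stmt-NavierStokesRegularity-20205)

MODEL lattice tables only; nothing about the Navier–Stokes equations; no item closed.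

The comparable circuit tables of the cell's numerics, in the tree's normalisation (`circuitTable`, module
`…CircuitTableDefs`: hand-off entry `k = Λ₀·K_cell`, `Λ₀ = bigLam ε₀ = (1+ε₀)^{5/2}`), belong to Tao's comparable
class for an explicit spread and an explicit range of scale ratios:
* `inTableClass_circuitTable_T4`: T4 = (q, e, E, Λ, K) = (1, 0.326, 0.134, 0.375, 0.618) gives
  `InTableClass 15 (circuitTable 1 0.326 0.134 0.375 (bigLam ε₀ * 0.618))` for `0 ≤ ε₀ ≤ 21/100`
  (binding constraints: `15⁻¹ ≤ 0.134/2` and `0.618·(1.21)^{5/2} = 0.618·1.1⁵ ≤ 1`); the cell's «spread 7.5» is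
  the ratio of the circuit CONSTANTS, the table spread is twice that because (4.2) splits every cross term;
* `inTableClass_circuitTable_B8`: B8 = (1, 0.61103, 0.14881, 0.22427, 0.70928) gives `InTableClass 14 (…)` for
  `0 ≤ ε₀ ≤ 1236/10000` (`1.1236 = 1.06²`, `0.70928·1.06⁵ ≤ 1`).
So p2's VALIDATED rows (T4 at ε₀ ∈ {0.03, 0.05, 0.1, 0.15, 0.2}, B8 at 0.08) concern tables INSIDE the classes
E₂(15) / E₂(14) over which `NoSurvivingDSSOne` quantifies (with `exists_inTableClass_surviving_dssWave_of_circuitDatum`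
this fixes the `R` of the would-be counter-instances: ε_s(15) < 0.03 conditional on the T4 @ 0.03 datum, etc.).
-/

noncomputable section

-- `Summit.NavierStokesRegularity.NavierStokesRegularity.…` is the tree's (summit = problem) namespace; the
-- duplicated component is intended, so the dupNamespace linter is silenced for this file.
set_option linter.dupNamespace false

namespace Summit.NavierStokesRegularity.NavierStokesRegularity.Theorems

open Literature.Analysis.FluidPDE Literature.Analysis.FluidPDE.TaoCascade

/-- `Λ₀ ≤ 1.1⁵ = 1.61051` for `0 ≤ ε₀ ≤ 0.21` (`1.21 = 1.1²`). [cite: Tao2016AveragedNS, §4 (4.1)] -/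
theorem bigLam_le_of_le_21 {ε₀ : ℝ} (hε0 : 0 ≤ ε₀) (hε : ε₀ ≤ 21 / 100) :
    bigLam ε₀ ≤ 161051 / 100000 := by
  unfold bigLam
  have h1 : (1 + ε₀) ^ ((5 : ℝ) / 2) ≤ (121 / 100 : ℝ) ^ ((5 : ℝ) / 2) :=
    Real.rpow_le_rpow (by linarith) (by linarith) (by norm_num)
  have h2 : (121 / 100 : ℝ) ^ ((5 : ℝ) / 2) = 161051 / 100000 := by
    rw [show (121 / 100 : ℝ) = (11 / 10) ^ (2 : ℝ) by norm_num, ← Real.rpow_mul (by norm_num)]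
    norm_num
  linarith

/-- `Λ₀ ≤ 1.06⁵` for `0 ≤ ε₀ ≤ 0.1236` (`1.1236 = 1.06²`). [cite: Tao2016AveragedNS, §4 (4.1)] -/
theorem bigLam_le_of_le_1236 {ε₀ : ℝ} (hε0 : 0 ≤ ε₀) (hε : ε₀ ≤ 1236 / 10000) :
    bigLam ε₀ ≤ 13382255776 / 10000000000 := by
  unfold bigLam
  have h1 : (1 + ε₀) ^ ((5 : ℝ) / 2) ≤ (11236 / 10000 : ℝ) ^ ((5 : ℝ) / 2) :=
    Real.rpow_le_rpow (by linarith) (by linarith) (by norm_num)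
  have h2 : (11236 / 10000 : ℝ) ^ ((5 : ℝ) / 2) = 13382255776 / 10000000000 := by
    rw [show (11236 / 10000 : ℝ) = (106 / 100) ^ (2 : ℝ) by norm_num, ← Real.rpow_mul (by norm_num)]
    norm_num
  linarith

/-- **T4 ∈ E₂(15) for `0 ≤ ε₀ ≤ 0.21`.** The cell's table T4 = (1, 0.326, 0.134, 0.375, 0.618) in the tree's
normalisation (`circuitTable 1 0.326 0.134 0.375 (bigLam ε₀ * 0.618)`) is symmetric, cancelling and
`15`-comparable. [cite: Tao2016AveragedNS, §4 (4.2)–(4.3), §6.1; cell vocabulary (`InTableClass`), harvest/h2-tao-ladder rung1 reports (table T4)] -/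
theorem inTableClass_circuitTable_T4 {ε₀ : ℝ} (hε0 : 0 ≤ ε₀) (hε : ε₀ ≤ 21 / 100) :
    InTableClass 15 (circuitTable 1 0.326 0.134 0.375 (bigLam ε₀ * 0.618)) := by
  have hL1 := one_le_bigLam hε0
  have hL2 := bigLam_le_of_le_21 hε0 hε
  refine inTableClass_circuitTable (by norm_num) (by norm_num) (by norm_num) (by norm_num) (by norm_num)
    (by norm_num) (by norm_num) (by norm_num) (by positivity) ?_ (by norm_num) (by norm_num) (by norm_num)
    (by norm_num) ?_
  · nlinarith
  · have : (15 : ℝ)⁻¹ ≤ 1 * 0.618 / 2 := by norm_num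
    nlinarith

/-- **B8 ∈ E₂(14) for `0 ≤ ε₀ ≤ 0.1236`.** The cell's second comparable table B8 = (1, 0.61103, 0.14881, 0.22427,
0.70928) in the tree's normalisation is symmetric, cancelling and `14`-comparable.
[cite: Tao2016AveragedNS, §4 (4.2)–(4.3), §6.1; cell vocabulary (`InTableClass`), harvest/h2-tao-ladder rung1 reports (table B8)] -/
theorem inTableClass_circuitTable_B8 {ε₀ : ℝ} (hε0 : 0 ≤ ε₀) (hε : ε₀ ≤ 1236 / 10000) :
    InTableClass 14 (circuitTable 1 0.61103 0.14881 0.22427 (bigLam ε₀ * 0.70928)) := by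
  have hL1 := one_le_bigLam hε0
  have hL2 := bigLam_le_of_le_1236 hε0 hε
  refine inTableClass_circuitTable (by norm_num) (by norm_num) (by norm_num) (by norm_num) (by norm_num)
    (by norm_num) (by norm_num) (by norm_num) (by positivity) ?_ (by norm_num) (by norm_num) (by norm_num)
    (by norm_num) ?_
  · nlinarith
  · have : (14 : ℝ)⁻¹ ≤ 1 * 0.70928 / 2 := by norm_num
    nlinarith

end Summit.NavierStokesRegularity.NavierStokesRegularity.Theorems
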